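import Literature.NumberTheory.Automorphic.CongruenceSubgroupPropertySL2Lemma5
import HarnessLib

/-!
# Serre's congruence subgroup property for `SL₂(𝓞_F)` — proofs, XIV: the symbol `[b over a]`
# on `W(𝔮, A)` with values in `G(𝔮, A)/E(𝔮, A)`; Liehl's (6)

Topic `Literature/NumberTheory/Automorphic`; namespace `Literature.NumberTheory.Automorphic.SL2Rel`.
Everything here is PROVED.  Definitions: `relEG 𝔮` (`E(𝔮, A)` inside `G(𝔮, A)`), the quotient
`SymbGroup 𝔮 = G(𝔮, A) ⧸ ncl E(𝔮, A)` (we divide by the normal closure, which is `E(𝔮, A)` itself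
once (5) is available, so that the quotient exists unconditionally), the Weyl element `weylElt`, and
the symbol `sym 𝔮 a b = [b over a] =` class of any `(a b; * *) ∈ G(𝔮, A)` (Liehl §3; `1` off `W`).

For the pair `(I₁, I₂) = (𝔮, A)` of Liehl §3 (the only one needed for Serre's theorem) we prove,
over any commutative ring: well-definedness (`sym_eq_mk`; rows of `W(𝔮, A)` are first rows of
`G(𝔮, A)`, `exists_relG_of_row`), **(6)** `[b over a] = [b + ax over a] = [b over a + by]`
(`x ∈ 𝔮`, `y ∈ A`), `[b over a] = 1` for `a ≡ 1 (mod b)`, and `w^{±1} E(I, I) w^{∓1} = E(I, I)`.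

## References

* [Liehl1981SL2Orders] B. Liehl, J. reine angew. Math. 323 (1981) 153–171, §3 up to (6).
* [Vaserstein1972SL2] L. N. Vaserstein, Mat. Sb. 89 (131) (1972) 313–322, Lemma 3 (a).
-/

open Matrix MatrixGroups NumberField

namespace Literature.NumberTheory.Automorphic

namespace SL2Rel

/-! ### The symbol group and the symbol, over any commutative ring -/

section CommRing

variable {R : Type*} [CommRing R]

/-- `E(𝔮, R)` as a subgroup of `G(𝔮, R)`. [cite: Liehl1981SL2Orders, §3] -/
abbrev relEG (𝔮 : Ideal R) : Subgroup (relG 𝔮 ⊤) := (relE 𝔮 ⊤).subgroupOf (relG 𝔮 ⊤)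

/-- The symbol group `G(𝔮, R) ⧸ ncl E(𝔮, R)` (equal to `G(𝔮, R) ⧸ E(𝔮, R)` when `E(𝔮, R)` is normal
in `G(𝔮, R)`, Liehl's (5)). [cite: Liehl1981SL2Orders, §3] -/
abbrev SymbGroup (𝔮 : Ideal R) : Type _ :=
  relG 𝔮 ⊤ ⧸ Subgroup.normalClosure (relEG 𝔮 : Set (relG 𝔮 ⊤))

/-- `E(𝔮, R)`-elements are trivial in the symbol group. [folklore] -/
theorem mk_eq_one_of_mem_relE {𝔮 : Ideal R} (α : relG 𝔮 ⊤) (h : (α : SL(2, R)) ∈ relE 𝔮 ⊤) :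
    (α : SymbGroup 𝔮) = 1 := by
  rw [QuotientGroup.eq_one_iff]
  exact Subgroup.subset_normalClosure (Subgroup.mem_subgroupOf.2 h)

/-- Right multiplication by `E(𝔮, R)` does not change the class. [folklore] -/
theorem mk_mul_eq_of_mem_relE {𝔮 : Ideal R} (α β : relG 𝔮 ⊤) (h : (β : SL(2, R)) ∈ relE 𝔮 ⊤) :
    ((α * β : relG 𝔮 ⊤) : SymbGroup 𝔮) = α := by
  rw [QuotientGroup.mk_mul, mk_eq_one_of_mem_relE β h, mul_one]

/-- Left multiplication by `E(𝔮, R)` does not change the class. [folklore] -/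
theorem mk_mul_eq_of_mem_relE' {𝔮 : Ideal R} (α β : relG 𝔮 ⊤) (h : (α : SL(2, R)) ∈ relE 𝔮 ⊤) :
    ((α * β : relG 𝔮 ⊤) : SymbGroup 𝔮) = β := by
  rw [QuotientGroup.mk_mul, mk_eq_one_of_mem_relE α h, one_mul]

/-- Two elements of `G(𝔮, R)` with the same first row have the same class (they differ by a left
factor `E₂₁(μ) ∈ E(𝔮, R)`). [cite: Liehl1981SL2Orders, §3] -/
theorem mk_eq_mk_of_row_eq {𝔮 : Ideal R} (α β : relG 𝔮 ⊤) (h0 : (α : SL(2, R)) 0 0 = (β : SL(2, R)) 0 0)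
    (h1 : (α : SL(2, R)) 0 1 = (β : SL(2, R)) 0 1) : (α : SymbGroup 𝔮) = β := by
  set μ : R := (α : SL(2, R)) 1 0 * (β : SL(2, R)) 1 1 - (α : SL(2, R)) 1 1 * (β : SL(2, R)) 1 0
    with hμ
  have he : e21 μ ∈ relG 𝔮 ⊤ := relE_le_relG _ _ (e21_mem_relE Submodule.mem_top)
  have key : (α : SL(2, R)) = e21 μ * (β : SL(2, R)) := by
    rw [hμ]; exact eq_e21_mul_of_row_eq _ _ h0 h1
  have hαβ : α = ⟨e21 μ, he⟩ * β := Subtype.ext key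
  rw [hαβ]
  exact mk_mul_eq_of_mem_relE' _ _ (e21_mem_relE Submodule.mem_top)

/-- A row `(a, b)` with `a - 1 ∈ I₁I₂`, `b ∈ I₁`, `(a, b) = 1` is the first row of
`(a b; mv 1-mu) ∈ G(I₁, I₂)` (`m = a - 1`, `ua + vb = 1`). [cite: Liehl1981SL2Orders, §3] -/
theorem exists_relG_of_row {I₁ I₂ : Ideal R} {a b : R} (ha : a - 1 ∈ I₁ * I₂) (hb : b ∈ I₁)
    (hab : IsCoprime a b) : ∃ α ∈ relG I₁ I₂, α 0 0 = a ∧ α 0 1 = b := by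
  obtain ⟨u, v, huv⟩ := hab
  refine ⟨⟨!![a, b; (a - 1) * v, 1 - (a - 1) * u], ?_⟩, ?_, rfl, rfl⟩
  · rw [Matrix.det_fin_two_of]; linear_combination (-(a - 1)) * huv
  · refine ⟨hb, Ideal.mul_le_left (I := I₁) (Ideal.mul_mem_right _ _ ha), ha, ?_⟩
    show 1 - (a - 1) * u - 1 ∈ I₁ * I₂
    rw [show 1 - (a - 1) * u - 1 = -((a - 1) * u) by ring]
    exact (I₁ * I₂).neg_mem (Ideal.mul_mem_right _ _ ha)

open Classical in
/-- **The symbol `[b over a]`** of Liehl §3 for the pair `(𝔮, R)`: the class in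
`G(𝔮, R) ⧸ ncl E(𝔮, R)` of any `(a b; * *) ∈ G(𝔮, R)` (and `1` if there is none, i.e. off
`W(𝔮, R)`). [cite: Liehl1981SL2Orders, §3] -/
noncomputable def sym (𝔮 : Ideal R) (a b : R) : SymbGroup 𝔮 :=
  if h : ∃ α : relG 𝔮 ⊤, (α : SL(2, R)) 0 0 = a ∧ (α : SL(2, R)) 0 1 = b then (h.choose : SymbGroup 𝔮)
  else 1

/-- The symbol is the class of any matrix with the given first row. [cite: Liehl1981SL2Orders, §3] -/
theorem sym_eq_mk {𝔮 : Ideal R} (α : relG 𝔮 ⊤) {a b : R} (h0 : (α : SL(2, R)) 0 0 = a)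
    (h1 : (α : SL(2, R)) 0 1 = b) : sym 𝔮 a b = α := by
  classical
  have h : ∃ α : relG 𝔮 ⊤, (α : SL(2, R)) 0 0 = a ∧ (α : SL(2, R)) 0 1 = b := ⟨α, h0, h1⟩
  rw [sym, dif_pos h]
  exact mk_eq_mk_of_row_eq _ _ (h.choose_spec.1.trans h0.symm) (h.choose_spec.2.trans h1.symm)

/-- `W(𝔮, R)`-rows are first rows of `G(𝔮, R)`. [cite: Liehl1981SL2Orders, §3] -/
theorem exists_sym_eq_mk {𝔮 : Ideal R} {a b : R} (ha : a - 1 ∈ 𝔮) (hb : b ∈ 𝔮)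
    (hab : IsCoprime a b) :
    ∃ α : relG 𝔮 ⊤, (α : SL(2, R)) 0 0 = a ∧ (α : SL(2, R)) 0 1 = b ∧ sym 𝔮 a b = α := by
  obtain ⟨α, hα, h0, h1⟩ := exists_relG_of_row (I₁ := 𝔮) (I₂ := ⊤) (by rwa [Ideal.mul_top]) hb hab
  exact ⟨⟨α, hα⟩, h0, h1, sym_eq_mk ⟨α, hα⟩ h0 h1⟩

/-- `[0 over 1] = 1`. [cite: Liehl1981SL2Orders, §3] -/
theorem sym_one_zero (𝔮 : Ideal R) : sym 𝔮 1 0 = 1 := by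
  rw [sym_eq_mk (1 : relG 𝔮 ⊤) (a := 1) (b := 0) (by simp) (by simp), QuotientGroup.mk_one]

/-- `[b over 1] = 1` for `b ∈ 𝔮` (the class of `E₁₂(b)`). [cite: Liehl1981SL2Orders, §3] -/
theorem sym_one_left {𝔮 : Ideal R} {b : R} (hb : b ∈ 𝔮) : sym 𝔮 1 b = 1 := by
  rw [sym_eq_mk (⟨e12 b, relE_le_relG _ _ (e12_mem_relE hb)⟩ : relG 𝔮 ⊤) (a := 1) (b := b)
    (e12_apply_00 b) (e12_apply_01 b)]
  exact mk_eq_one_of_mem_relE _ (e12_mem_relE hb)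

/-- **Liehl (6), first half**: `[b over a] = [b + ax over a]` for `x ∈ 𝔮`.
[cite: Liehl1981SL2Orders, §3 (6)] -/
theorem sym_add_mul_right {𝔮 : Ideal R} {a b : R} (ha : a - 1 ∈ 𝔮) (hb : b ∈ 𝔮)
    (hab : IsCoprime a b) {x : R} (hx : x ∈ 𝔮) : sym 𝔮 a (b + x * a) = sym 𝔮 a b := by
  obtain ⟨α, h0, h1, hs⟩ := exists_sym_eq_mk ha hb hab
  set ε : relG 𝔮 ⊤ := ⟨e12 x, relE_le_relG _ _ (e12_mem_relE hx)⟩ with hε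
  obtain ⟨k0, k1, -, -⟩ := mul_e12_apply (α : SL(2, R)) x
  rw [hs, sym_eq_mk (α * ε) (by rw [← h0]; exact k0) (by rw [← h0, ← h1, Subgroup.coe_mul, k1]; ring)]
  exact mk_mul_eq_of_mem_relE α ε (e12_mem_relE hx)

/-- **Liehl (6), second half**: `[b over a] = [b over a + by]` for all `y`.
[cite: Liehl1981SL2Orders, §3 (6)] -/
theorem sym_add_mul_left {𝔮 : Ideal R} {a b : R} (ha : a - 1 ∈ 𝔮) (hb : b ∈ 𝔮)
    (hab : IsCoprime a b) (y : R) : sym 𝔮 (a + y * b) b = sym 𝔮 a b := by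
  obtain ⟨α, h0, h1, hs⟩ := exists_sym_eq_mk ha hb hab
  set ε : relG 𝔮 ⊤ := ⟨e21 y, relE_le_relG _ _ (e21_mem_relE Submodule.mem_top)⟩ with hε
  obtain ⟨k0, k1, -, -⟩ := mul_e21_apply (α : SL(2, R)) y
  rw [hs, sym_eq_mk (α * ε) (by rw [← h0, ← h1, Subgroup.coe_mul, k0]; ring)
    (by rw [← h1]; exact k1)]
  exact mk_mul_eq_of_mem_relE α ε (e21_mem_relE Submodule.mem_top)

/-- `[b over a] = 1` if `a ≡ 1 (mod b)`. [cite: Liehl1981SL2Orders, §3 (6)] -/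
theorem sym_eq_one_of_sub_one_mem_span {𝔮 : Ideal R} {a b : R} (hb : b ∈ 𝔮)
    (h : a - 1 ∈ Ideal.span {b}) : sym 𝔮 a b = 1 := by
  obtain ⟨t, ht⟩ := Ideal.mem_span_singleton'.1 h
  have ha : a = 1 + t * b := by linear_combination -ht
  rw [ha, sym_add_mul_left (by simp) hb isCoprime_one_left t, sym_one_left hb]

/-- The Weyl element `w = (0 -1; 1 0)`. [folklore] -/
def weylElt : SL(2, R) := ⟨!![0, -1; 1, 0], by simp [Matrix.det_fin_two_of]⟩

/-- Entry `(0,0)` of `w`. [folklore] -/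
@[simp] theorem weylElt_apply_00 : (weylElt : SL(2, R)) 0 0 = 0 := rfl

/-- Entry `(0,1)` of `w`. [folklore] -/
@[simp] theorem weylElt_apply_01 : (weylElt : SL(2, R)) 0 1 = -1 := rfl

/-- Entry `(1,0)` of `w`. [folklore] -/
@[simp] theorem weylElt_apply_10 : (weylElt : SL(2, R)) 1 0 = 1 := rfl

/-- Entry `(1,1)` of `w`. [folklore] -/
@[simp] theorem weylElt_apply_11 : (weylElt : SL(2, R)) 1 1 = 0 := rfl

/-- Entries of `w⁻¹ M w = (d, -c; -b, a)`. [folklore] -/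
theorem weylElt_inv_mul_mul_apply (M : SL(2, R)) :
    ((weylElt : SL(2, R))⁻¹ * M * (weylElt : SL(2, R))) 0 0 = M 1 1 ∧
    ((weylElt : SL(2, R))⁻¹ * M * (weylElt : SL(2, R))) 0 1 = -M 1 0 ∧
    ((weylElt : SL(2, R))⁻¹ * M * (weylElt : SL(2, R))) 1 0 = -M 0 1 ∧
    ((weylElt : SL(2, R))⁻¹ * M * (weylElt : SL(2, R))) 1 1 = M 0 0 := by
  obtain ⟨i00, i01, i10, i11⟩ := inv_apply_two (weylElt : SL(2, R))
  simp only [mul_apply_two, i00, i01, i10, i11, weylElt_apply_00, weylElt_apply_01,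
    weylElt_apply_10, weylElt_apply_11]
  refine ⟨?_, ?_, ?_, ?_⟩ <;> ring

/-- `w⁻¹ E₁₂(x) w = E₂₁(-x)`. [folklore] -/
theorem weylElt_inv_mul_e12_mul (x : R) :
    (weylElt : SL(2, R))⁻¹ * e12 x * weylElt = e21 (-x) := by
  rw [mul_assoc, inv_mul_eq_iff_eq_mul]
  ext i j
  fin_cases i <;> fin_cases j <;> simp [weylElt, mul_apply_two]

/-- `w⁻¹ E₂₁(y) w = E₁₂(-y)`. [folklore] -/
theorem weylElt_inv_mul_e21_mul (y : R) :
    (weylElt : SL(2, R))⁻¹ * e21 y * weylElt = e12 (-y) := by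
  rw [mul_assoc, inv_mul_eq_iff_eq_mul]
  ext i j
  fin_cases i <;> fin_cases j <;> simp [weylElt, mul_apply_two]

/-- `w E₁₂(x) w⁻¹ = E₂₁(-x)`. [folklore] -/
theorem weylElt_mul_e12_mul_inv (x : R) :
    (weylElt : SL(2, R)) * e12 x * weylElt⁻¹ = e21 (-x) := by
  rw [mul_inv_eq_iff_eq_mul]
  ext i j
  fin_cases i <;> fin_cases j <;> simp [weylElt, mul_apply_two]

/-- `w E₂₁(y) w⁻¹ = E₁₂(-y)`. [folklore] -/
theorem weylElt_mul_e21_mul_inv (y : R) :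
    (weylElt : SL(2, R)) * e21 y * weylElt⁻¹ = e12 (-y) := by
  rw [mul_inv_eq_iff_eq_mul]
  ext i j
  fin_cases i <;> fin_cases j <;> simp [weylElt, mul_apply_two]

/-- `w⁻¹ E(I, I) w = E(I, I)`. [folklore] -/
theorem weylElt_inv_conj_mem_relE {I : Ideal R} {E : SL(2, R)} (hE : E ∈ relE I I) :
    (weylElt : SL(2, R))⁻¹ * E * weylElt ∈ relE I I := by
  have h : (relE I I).map (MulAut.conj (weylElt : SL(2, R)))⁻¹.toMonoidHom ≤ relE I I := by
    rw [relE, MonoidHom.map_closure, Subgroup.closure_le]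
    rintro _ ⟨M, hM | hM, rfl⟩
    · obtain ⟨x, hx, rfl⟩ := hM
      rw [MulEquiv.coe_toMonoidHom, MulAut.conj_inv_apply, weylElt_inv_mul_e12_mul]
      exact e21_mem_relE (I.neg_mem hx)
    · obtain ⟨y, hy, rfl⟩ := hM
      rw [MulEquiv.coe_toMonoidHom, MulAut.conj_inv_apply, weylElt_inv_mul_e21_mul]
      exact e12_mem_relE (I.neg_mem hy)
  exact h (Subgroup.mem_map_of_mem (MulAut.conj (weylElt : SL(2, R)))⁻¹.toMonoidHom hE)

/-- `w E(I, I) w⁻¹ = E(I, I)`. [folklore] -/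
theorem weylElt_conj_mem_relE {I : Ideal R} {E : SL(2, R)} (hE : E ∈ relE I I) :
    (weylElt : SL(2, R)) * E * weylElt⁻¹ ∈ relE I I := by
  have h : (relE I I).map (MulAut.conj (weylElt : SL(2, R))).toMonoidHom ≤ relE I I := by
    rw [relE, MonoidHom.map_closure, Subgroup.closure_le]
    rintro _ ⟨M, hM | hM, rfl⟩
    · obtain ⟨x, hx, rfl⟩ := hM
      rw [MulEquiv.coe_toMonoidHom, MulAut.conj_apply, weylElt_mul_e12_mul_inv]
      exact e21_mem_relE (I.neg_mem hx)
    · obtain ⟨y, hy, rfl⟩ := hM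
      rw [MulEquiv.coe_toMonoidHom, MulAut.conj_apply, weylElt_mul_e21_mul_inv]
      exact e12_mem_relE (I.neg_mem hy)
  exact h (Subgroup.mem_map_of_mem _ hE)

end CommRing

end SL2Rel

end Literature.NumberTheory.Automorphic
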